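import Literature.MathematicalPhysics.QuantumFieldTheory.Federbush1986.LandauPenaltyDictionary
import Literature.MathematicalPhysics.QuantumFieldTheory.Federbush1986.ModeLinearity
import Mathlib.Analysis.Calculus.LineDeriv.IntegrationByParts

/-!
# `Federbush1986.LandauPenaltyEulerLagrange` — [Federbush1986PhaseCellI] §3 p. 327–328: «From (3.4) we see the
# minimizing A′ will satisfy A′ = α²C Σ_γ β_γχ_γ (3.11)» IN POSITION SPACE, for the verbatim bodies of (3.4) and (3.5):
# the first variation of the penalised action, minimiser ⇔ Euler–Lagrange, and `D A′ = α² Σ_γ β_γ χ_γ` in the sense of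
# distributions

statement-level skeleton of published theorems with citation tags; proofs where landed; nothing here is a claim about the Yang–Mills mass gap

CITATION HEADER.  P. Federbush, *A phase cell approach to Yang–Mills theory. I. Modes, lattice-continuum duality*, Commun.
Math. Phys. **107** (1986) 319–329 [Federbush1986PhaseCellI], §3 «The Potential A_μ(x) of a Single Excitation», p. 327–328,
displays (3.3)–(3.5), (3.11) (page images `run/shared/lean/pub/lit-balaban/lit-balaban-r17/renders/fedI/fed1986-cmp107-p009-x2.png`,
`-p010-x2.png`, re-read first-hand for this file).  Unit `lit-balaban-r17` gen 59 (fold owner of the Federbush block), SKELETON row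
**F1.Eq3.2-3.12** of `run/shared/lean/pub/lit-balaban/lit-balaban-r17/SKELETON-r17.md` (member M″ named in that row's record by
r17 gen 58; HONEST SCOPE (b) of `LandauPenaltyFibre`).  HOME `run/shared/lean/pub/lit-balaban/`.

WHAT PRINT SAYS (p. 327–328).  «We thus have prescribed (χ_p, A) = β_p, p ∈ ℒ⁰. (3.3) … We seek a minimum of the action S,
for a Landau gauge A′, a gauge transformation of A.  S = ½∫Σ_{i,j}(∂A′_i/∂x_j)² + ½α² Σ_{p∈ℒ⁰} ((χ_p, A′) − β_p)², (3.4) and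
then take the limit α → ∞. (Alternatively one could use Lagrange multipliers.)  We let D be the differential-integral operator
D = −Δ + α² Σ_γ χ_γχ_γ. (3.5)  The sum over γ is understood to be over plaquettes in ℒ⁰.  We now exhibit the Fourier transform
of C = D⁻¹, … (3.6) … (3.7) … From (3.4) we see the minimizing A′ will satisfy A′ = α²C Σ_γ β_γχ_γ. (3.11)»

WHAT THIS FILE PROVES (kernel-checked; `def`s with bodies; 0 `Prop`-valued definitions, 0 named facts, 0 `sorry`).  The tree
holds (3.4) and (3.5) verbatim in position space as `LandauPenalty.penaltyActionFix` / `LandauPenalty.opDPosFix`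
(`LandauPenaltyDictionary`, r17 g58; print's one fixed orientation per plaquette, (3.9)), «C = D⁻¹» as the two-sided inverse on
every momentum fibre (`PlaquetteGram.opC_opD` / `opD_opC`, `LandauPenaltyFibre`, r17 g57) and the sentence «From (3.4) we see
the minimizing A′ will satisfy (3.11)» ON THE FIBRE (`PlaquetteGram.opD_eq_src_of_isMin`: minimality of the fibre density
against one-site perturbations ⇒ `D f = α² src`).  Here the same sentence is made a theorem IN POSITION SPACE, for print's `S`
and `D` themselves, by the calculus of variations:
* §1 `firstVar α β A′ φ = ∫ Σ_{i,j} ∂_jA′_i ∂_jφ_i d⁴x + α² Σ_{(b,a)} ((χ_{⟨b,a⟩}, A′) − β_{⟨b,a⟩})(χ_{⟨b,a⟩}, φ)` (the first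
  variation of (3.4)), and **`penaltyActionFix_add_smul`**: for a `C¹` field `A′` of finite penalised action (`Σ_{i,j}(∂_jA′_i)²`
  integrable, the penalty sum summable) and every `C¹` compactly supported `φ`,
  `S(A′ + tφ) = S(A′) + t·firstVar(A′; φ) + t²·S₀(φ)` with `S₀ φ = penaltyActionFix α 0 φ ≥ 0` (the penalty sum of `φ` is a
  FINITE sum: a compactly supported field pairs non-trivially with finitely many plaquettes, `exists_finset_plaqFunctional_eq_zero`).
* §2 **`firstVar_eq_zero_of_isMin`** / **`isMin_of_firstVar_eq_zero`** / `isMin_iff_firstVar_eq_zero`: `A′` minimises (3.4)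
  against every smooth compactly supported perturbation ⇔ its first variation vanishes on all of them (convexity of `S`).
* §3 integration by parts (Mathlib's `integral_mul_fderiv_eq_neg_fderiv_mul_of_integrable`) and the exchange of the (finite)
  plaquette sum with `∫d⁴x`: **`firstVar_eq_integral_opDPosFix`** `firstVar(A′; φ) = ∫ A′·(Dφ) d⁴x − α² Σ_γ β_γ (χ_γ, φ)` with
  `D = opDPosFix α` = (3.5); hence **`integral_mul_opDPosFix_eq_of_isMin`**: a minimiser satisfies
  `∫ A′·(Dφ) d⁴x = α² Σ_γ β_γ (χ_γ, φ)` for every test field `φ` — `D A′ = α² Σ_γ β_γ χ_γ` in the sense of distributions, i.e.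
  (3.11) `A′ = α² C Σ_γ β_γ χ_γ` read through «C = D⁻¹»; and conversely (**`isMin_iff_integral_mul_opDPosFix_eq`**).
* §4 the right side as a field: `srcPos α β = α² Σ_γ β_γ χ_γ` (a locally finite sum, every `β`), **`integral_srcPos_mul`**
  `∫ (α² Σ_γ β_γ χ_γ)·φ d⁴x = α² Σ_γ β_γ (χ_γ, φ)`, so the minimiser's equation reads `∫ A′·(Dφ) = ∫ (α²Σ_γ β_γχ_γ)·φ`
  (**`weak311_of_isMin`**); `D` is symmetric on the test fields (`integral_mul_opDPosFix_comm`).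

HONEST SCOPE.  (a) «minimizing» = minimality of print's `S` (3.4) against smooth compactly supported perturbations `A′ + φ` of a
`C¹` field `A′` with finite penalised action relative to `β` (every minimiser over any larger class is one); the conclusion is the
Euler–Lagrange equation `D A′ = α² Σ_γ β_γ χ_γ` tested against `C_c^∞(ℝ⁴; ℝ⁴)` — print's (3.11) composed with «C = D⁻¹», which the
tree proves on every momentum fibre (`opC_opD`); the identification of `∫ A′·(Dφ)` with the fibre pairing is the dictionary of
`LandauPenaltyDictionary` (D2 `fib_opDPosFix`, on the core).  (b) EXISTENCE and uniqueness of a minimiser, its regularity/decay,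
and the limit `α → ∞` ((3.12)) are not asserted here (see `LandauModeFormula`, `ConstrainedMinimality` for the `α = ∞` mode).
(c) `β` arbitrary (print: the level-0 plaquette variables of a single excitation).  (d) No `Prop`-valued definition, no named
fact (D-0026); axioms standard.
-/

namespace Literature.MathematicalPhysics.QuantumFieldTheory.Federbush1986

noncomputable section

open MeasureTheory Filter Topology Set
open scoped BigOperators ContDiff

namespace LandauPenalty

open PlaquetteGram

variable {A φ ψ : E4 → Fin 4 → ℝ} {α : ℝ} {β : Plaq 0 → ℝ}

/-! ## §0 Calculus bookkeeping: `∂` of `C¹` fields, plaquette variables of sums, finitely many plaquettes see a test field -/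

/-- `∂_νA_μ` of a `C¹` field is continuous. [cite: Federbush1986PhaseCellI, (3.4) p. 327] -/
theorem continuous_pd_of_contDiff (hA : ContDiff ℝ 1 A) (ν μ : Fin 4) : Continuous fun x => pd A ν μ x := by
  unfold pd
  exact ((contDiff_pi.1 hA μ).continuous_fderiv one_ne_zero).clm_apply continuous_const

/-- A smooth field is `C¹`. [folklore] -/
private theorem contDiff_one_of_smooth (hφ : ContDiff ℝ ∞ φ) : ContDiff ℝ 1 φ :=
  hφ.of_le (by exact_mod_cast le_top)

/-- Components of a continuous field are continuous. [folklore] -/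
private theorem continuous_apply_field (hA : Continuous A) (μ : Fin 4) : Continuous fun x => A x μ :=
  (continuous_apply μ).comp hA

/-- `t • φ` is compactly supported with `φ`. [folklore] -/
private theorem hasCompactSupport_const_smul (hφs : HasCompactSupport φ) (t : ℝ) : HasCompactSupport (t • φ) :=
  hφs.mono fun x hx => Function.mem_support.mpr fun h => Function.mem_support.mp hx (by simp [h])

/-- `(χ_q, A + φ) = (χ_q, A) + (χ_q, φ)` for continuous fields (the plaquette functional is an integral against `χ_q`).
[cite: Federbush1986PhaseCellI, (1.13)–(1.14) p. 324, (3.3) p. 327] -/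
theorem plaqFunctional_add (hA : Continuous A) (hφ : Continuous φ) (q : Plaq 0) :
    plaqFunctional 0 (A + φ) q = plaqFunctional 0 A q + plaqFunctional 0 φ q := by
  rw [plaqFunctional_eq_integral_plaqTestField hA, plaqFunctional_eq_integral_plaqTestField hφ,
    plaqFunctional_eq_integral_plaqTestField (show Continuous (A + φ) from hA.add hφ),
    ← integral_add (integrable_sum_plaqTestField_mul hA q) (integrable_sum_plaqTestField_mul hφ q)]
  refine integral_congr_ae (ae_of_all _ fun z => ?_)
  simp only [Pi.add_apply, mul_add, Finset.sum_add_distrib]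

/-- `(χ_q, A + tφ) = (χ_q, A) + t (χ_q, φ)`. [cite: Federbush1986PhaseCellI, (3.3)–(3.4) p. 327] -/
theorem plaqFunctional_add_smul (hA : Continuous A) (hφ : Continuous φ) (t : ℝ) (q : Plaq 0) :
    plaqFunctional 0 (A + t • φ) q = plaqFunctional 0 A q + t * plaqFunctional 0 φ q := by
  rw [plaqFunctional_add hA (show Continuous (t • φ) from hφ.const_smul t) q, plaqFunctional_const_smul hφ t q]

/-- **A compactly supported field pairs non-trivially with only finitely many plaquettes**: there is a finite set of corners
outside which `(χ_{⟨b,a⟩}, φ) = 0` for all six axis pairs `a` (so the penalty sum of (3.4) is a finite sum for test fields).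
[cite: Federbush1986PhaseCellI, (3.4) p. 327, (3.9) p. 328] -/
theorem exists_finset_plaqFunctional_eq_zero (hφ : Continuous φ) (hφs : HasCompactSupport φ) :
    ∃ S : Finset (Fin 4 → ℤ), ∀ ba : (Fin 4 → ℤ) × Fin 6, ba.1 ∉ S → plaqFunctional 0 φ (plaqAt ba.1 ba.2) = 0 := by
  obtain ⟨S, hS⟩ := exists_finset_pairT_eq_zero hφs
  exact ⟨S, fun ba hba => plaqFunctional_eq_zero_of_base hφ hS _ hba⟩

/-- The same finiteness on the product index `(b, a) ∈ ℤ⁴ × 6`. [cite: Federbush1986PhaseCellI, (3.4) p. 327, (3.9) p. 328] -/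
theorem exists_finset_prod_plaqFunctional_eq_zero (hφ : Continuous φ) (hφs : HasCompactSupport φ) :
    ∃ T : Finset ((Fin 4 → ℤ) × Fin 6), ∀ ba ∉ T, plaqFunctional 0 φ (plaqAt ba.1 ba.2) = 0 := by
  obtain ⟨S, hS⟩ := exists_finset_plaqFunctional_eq_zero hφ hφs
  exact ⟨S ×ˢ Finset.univ, fun ba hba => hS ba fun h => hba (Finset.mem_product.mpr ⟨h, Finset.mem_univ _⟩)⟩

/-! ## §1 The first variation of (3.4) -/

/-- **The first variation of the penalised action (3.4)** at `A′` along `φ`: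
`δS(A′; φ) = ∫ Σ_{i,j} ∂_jA′_i ∂_jφ_i d⁴x + α² Σ_{(b,a)} ((χ_{⟨b,a⟩}, A′) − β_{⟨b,a⟩}) (χ_{⟨b,a⟩}, φ)` (print's one orientation per
plaquette, as in `penaltyActionFix`). [cite: Federbush1986PhaseCellI, (3.4) p. 327, (3.11) p. 328] -/
def firstVar (α : ℝ) (β : Plaq 0 → ℝ) (A φ : E4 → Fin 4 → ℝ) : ℝ :=
  (∫ x, ∑ i, ∑ j, pd A j i x * pd φ j i x)
    + α ^ 2 * ∑' ba : (Fin 4 → ℤ) × Fin 6,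
        (plaqFunctional 0 A (plaqAt ba.1 ba.2) - β (plaqAt ba.1 ba.2)) * plaqFunctional 0 φ (plaqAt ba.1 ba.2)

/-- The cross term `Σ_{i,j} ∂_jA_i ∂_jφ_i` of a `C¹` field against a `C¹` compactly supported field is integrable.
[cite: Federbush1986PhaseCellI, (3.4) p. 327] -/
theorem integrable_kinCross (hA : ContDiff ℝ 1 A) (hφ : ContDiff ℝ 1 φ) (hφs : HasCompactSupport φ) :
    Integrable fun x => ∑ i, ∑ j, pd A j i x * pd φ j i x :=
  integrable_finsetSum _ fun i _ => integrable_finsetSum _ fun j _ =>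
    ((continuous_pd_of_contDiff hA j i).mul (continuous_pd_of_contDiff hφ j i)).integrable_of_hasCompactSupport
      (HasCompactSupport.mul_left (f := fun x => pd A j i x) (hasCompactSupport_pd hφs j i))

/-- The kinetic density `Σ_{i,j}(∂_jφ_i)²` of a `C¹` compactly supported field is integrable. [cite: Federbush1986PhaseCellI, (3.4) p. 327] -/
theorem integrable_kin_of_hasCompactSupport (hφ : ContDiff ℝ 1 φ) (hφs : HasCompactSupport φ) :
    Integrable fun x => ∑ i, ∑ j, (pd φ j i x) ^ 2 := by
  have h : (fun x => ∑ i, ∑ j, (pd φ j i x) ^ 2) = fun x => ∑ i, ∑ j, pd φ j i x * pd φ j i x := by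
    funext x; simp only [sq]
  rw [h]
  exact integrable_kinCross hφ hφ hφs

/-- **The kinetic term of (3.4) along a line**: `∫Σ(∂_j(A + tφ)_i)² = ∫Σ(∂_jA_i)² + 2t∫Σ∂_jA_i∂_jφ_i + t²∫Σ(∂_jφ_i)²`.
[cite: Federbush1986PhaseCellI, (3.4) p. 327] -/
theorem integral_kin_add_smul (hA : ContDiff ℝ 1 A) (hkin : Integrable fun x => ∑ i, ∑ j, (pd A j i x) ^ 2)
    (hφ : ContDiff ℝ 1 φ) (hφs : HasCompactSupport φ) (t : ℝ) :
    ∫ x, ∑ i, ∑ j, (pd (A + t • φ) j i x) ^ 2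
      = (∫ x, ∑ i, ∑ j, (pd A j i x) ^ 2) + 2 * t * (∫ x, ∑ i, ∑ j, pd A j i x * pd φ j i x)
        + t ^ 2 * ∫ x, ∑ i, ∑ j, (pd φ j i x) ^ 2 := by
  have hφt : ContDiff ℝ 1 (t • φ) := by
    show ContDiff ℝ 1 fun x => t • φ x
    exact hφ.const_smul t
  have hpt : ∀ x i j, pd (A + t • φ) j i x = pd A j i x + t * pd φ j i x := fun x i j => by
    rw [ModeLinearity.pd_add hA hφt, ModeLinearity.pd_smul hφ]
  have hcross := integrable_kinCross hA hφ hφs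
  have hφφ := integrable_kin_of_hasCompactSupport hφ hφs
  have h2 : (fun x => ∑ i, ∑ j, (pd (A + t • φ) j i x) ^ 2)
      = fun x => (∑ i, ∑ j, (pd A j i x) ^ 2) + 2 * t * (∑ i, ∑ j, pd A j i x * pd φ j i x)
          + t ^ 2 * ∑ i, ∑ j, (pd φ j i x) ^ 2 := by
    funext x
    simp only [hpt, Finset.mul_sum, ← Finset.sum_add_distrib]
    exact Finset.sum_congr rfl fun i _ => Finset.sum_congr rfl fun j _ => by ring
  have hI1 : Integrable fun x => (∑ i, ∑ j, (pd A j i x) ^ 2) + 2 * t * (∑ i, ∑ j, pd A j i x * pd φ j i x) :=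
    hkin.add (hcross.const_mul (2 * t))
  rw [h2, integral_add hI1 (hφφ.const_mul _), integral_add hkin (hcross.const_mul _),
    integral_const_mul, integral_const_mul]

/-- **The penalty term of (3.4) along a line**: with `P = (χ, A) − β`, `Q = (χ, φ)` (finitely supported),
`Σ'(P + tQ)² = Σ'P² + 2tΣ'PQ + t²Σ'Q²`. [cite: Federbush1986PhaseCellI, (3.4) p. 327] -/
theorem tsum_pen_add_smul (hA : Continuous A)
    (hpen : Summable fun ba : (Fin 4 → ℤ) × Fin 6 => (plaqFunctional 0 A (plaqAt ba.1 ba.2) - β (plaqAt ba.1 ba.2)) ^ 2)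
    (hφ : Continuous φ) (hφs : HasCompactSupport φ) (t : ℝ) :
    ∑' ba : (Fin 4 → ℤ) × Fin 6, (plaqFunctional 0 (A + t • φ) (plaqAt ba.1 ba.2) - β (plaqAt ba.1 ba.2)) ^ 2
      = (∑' ba : (Fin 4 → ℤ) × Fin 6, (plaqFunctional 0 A (plaqAt ba.1 ba.2) - β (plaqAt ba.1 ba.2)) ^ 2)
        + 2 * t * (∑' ba : (Fin 4 → ℤ) × Fin 6,
            (plaqFunctional 0 A (plaqAt ba.1 ba.2) - β (plaqAt ba.1 ba.2)) * plaqFunctional 0 φ (plaqAt ba.1 ba.2))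
        + t ^ 2 * ∑' ba : (Fin 4 → ℤ) × Fin 6, (plaqFunctional 0 φ (plaqAt ba.1 ba.2)) ^ 2 := by
  obtain ⟨T, hQ⟩ := exists_finset_prod_plaqFunctional_eq_zero hφ hφs
  have hPQ : Summable fun ba : (Fin 4 → ℤ) × Fin 6 =>
      (plaqFunctional 0 A (plaqAt ba.1 ba.2) - β (plaqAt ba.1 ba.2)) * plaqFunctional 0 φ (plaqAt ba.1 ba.2) :=
    summable_of_ne_finset_zero (s := T) fun ba hba => by rw [hQ ba hba, mul_zero]
  have hQQ : Summable fun ba : (Fin 4 → ℤ) × Fin 6 => (plaqFunctional 0 φ (plaqAt ba.1 ba.2)) ^ 2 :=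
    summable_of_ne_finset_zero (s := T) fun ba hba => by rw [hQ ba hba]; ring
  have hpt : (fun ba : (Fin 4 → ℤ) × Fin 6 => (plaqFunctional 0 (A + t • φ) (plaqAt ba.1 ba.2) - β (plaqAt ba.1 ba.2)) ^ 2)
      = fun ba => ((plaqFunctional 0 A (plaqAt ba.1 ba.2) - β (plaqAt ba.1 ba.2)) ^ 2
          + 2 * t * ((plaqFunctional 0 A (plaqAt ba.1 ba.2) - β (plaqAt ba.1 ba.2)) * plaqFunctional 0 φ (plaqAt ba.1 ba.2)))
          + t ^ 2 * (plaqFunctional 0 φ (plaqAt ba.1 ba.2)) ^ 2 := by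
    funext ba
    rw [plaqFunctional_add_smul hA hφ]
    ring
  rw [hpt, (hpen.add (hPQ.mul_left (2 * t))).tsum_add (hQQ.mul_left (t ^ 2)), hpen.tsum_add (hPQ.mul_left (2 * t)),
    tsum_mul_left, tsum_mul_left]

/-- **(3.4) ALONG A LINE OF COMPETITORS — the second-order expansion.**  For a `C¹` field `A′` with `Σ_{i,j}(∂_jA′_i)²` integrable
and summable penalty, and a `C¹` compactly supported `φ`:
`S(A′ + tφ) = S(A′) + t·δS(A′; φ) + t²·S₀(φ)`, `S₀(φ) = penaltyActionFix α 0 φ` (the penalised action of `φ` with zero data).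
[cite: Federbush1986PhaseCellI, (3.4) p. 327, (3.11) p. 328] -/
theorem penaltyActionFix_add_smul (hA : ContDiff ℝ 1 A) (hkin : Integrable fun x => ∑ i, ∑ j, (pd A j i x) ^ 2)
    (hpen : Summable fun ba : (Fin 4 → ℤ) × Fin 6 => (plaqFunctional 0 A (plaqAt ba.1 ba.2) - β (plaqAt ba.1 ba.2)) ^ 2)
    (hφ : ContDiff ℝ 1 φ) (hφs : HasCompactSupport φ) (t : ℝ) :
    penaltyActionFix α β (A + t • φ)
      = penaltyActionFix α β A + t * firstVar α β A φ + t ^ 2 * penaltyActionFix α 0 φ := by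
  unfold penaltyActionFix firstVar
  rw [integral_kin_add_smul hA hkin hφ hφs t, tsum_pen_add_smul hA.continuous hpen hφ.continuous hφs t]
  simp only [Pi.zero_apply, sub_zero]
  ring

/-! ## §2 Minimiser ⇔ vanishing first variation -/

/-- `S ≥ 0`. [cite: Federbush1986PhaseCellI, (3.4) p. 327] -/
theorem penaltyActionFix_nonneg (α : ℝ) (β : Plaq 0 → ℝ) (A : E4 → Fin 4 → ℝ) : 0 ≤ penaltyActionFix α β A := by
  unfold penaltyActionFix
  have h1 : 0 ≤ ∫ x, ∑ i, ∑ j, (pd A j i x) ^ 2 :=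
    integral_nonneg fun x => Finset.sum_nonneg fun i _ => Finset.sum_nonneg fun j _ => sq_nonneg _
  have h2 : 0 ≤ ∑' ba : (Fin 4 → ℤ) × Fin 6, (plaqFunctional 0 A (plaqAt ba.1 ba.2) - β (plaqAt ba.1 ba.2)) ^ 2 :=
    tsum_nonneg fun _ => sq_nonneg _
  positivity

/-- A real quadratic `t ↦ tb + t²c` (`c ≥ 0`) that is non-negative for all `t` has `b = 0`. [folklore] -/
private theorem linear_coeff_eq_zero {b c : ℝ} (hc : 0 ≤ c) (h : ∀ t : ℝ, 0 ≤ t * b + t ^ 2 * c) : b = 0 := by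
  by_contra hb
  have hc1 : 0 < c + 1 := by linarith
  have ht := h (-b / (c + 1))
  have key : -b / (c + 1) * b + (-b / (c + 1)) ^ 2 * c = -(b ^ 2 / (c + 1) ^ 2) := by
    field_simp
    ring
  have hpos : 0 < b ^ 2 / (c + 1) ^ 2 := by positivity
  linarith

/-- **«the minimizing A′» ⇒ EULER–LAGRANGE**: if the `C¹` field `A′` (finite penalised action) minimises (3.4) against every smooth
compactly supported perturbation, its first variation vanishes on every such `φ`. [cite: Federbush1986PhaseCellI, (3.4) p. 327, (3.11) p. 328] -/
theorem firstVar_eq_zero_of_isMin (hA : ContDiff ℝ 1 A) (hkin : Integrable fun x => ∑ i, ∑ j, (pd A j i x) ^ 2)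
    (hpen : Summable fun ba : (Fin 4 → ℤ) × Fin 6 => (plaqFunctional 0 A (plaqAt ba.1 ba.2) - β (plaqAt ba.1 ba.2)) ^ 2)
    (hmin : ∀ φ : E4 → Fin 4 → ℝ, ContDiff ℝ ∞ φ → HasCompactSupport φ →
      penaltyActionFix α β A ≤ penaltyActionFix α β (A + φ))
    (hφ : ContDiff ℝ ∞ φ) (hφs : HasCompactSupport φ) : firstVar α β A φ = 0 := by
  refine linear_coeff_eq_zero (penaltyActionFix_nonneg α 0 φ) fun t => ?_
  have h1 := hmin (t • φ) (show ContDiff ℝ ∞ fun x => t • φ x from hφ.const_smul t) (hasCompactSupport_const_smul hφs t)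
  have h2 := penaltyActionFix_add_smul hA hkin hpen (contDiff_one_of_smooth hφ) hφs t (α := α) (β := β)
  linarith

/-- **EULER–LAGRANGE ⇒ minimiser** (convexity of (3.4)): if the first variation of `A′` vanishes on every smooth compactly supported
`φ`, then `S(A′) ≤ S(A′ + φ)` for every such `φ` — indeed `S(A′ + φ) = S(A′) + S₀(φ)`. [cite: Federbush1986PhaseCellI, (3.4) p. 327, (3.11) p. 328] -/
theorem isMin_of_firstVar_eq_zero (hA : ContDiff ℝ 1 A) (hkin : Integrable fun x => ∑ i, ∑ j, (pd A j i x) ^ 2)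
    (hpen : Summable fun ba : (Fin 4 → ℤ) × Fin 6 => (plaqFunctional 0 A (plaqAt ba.1 ba.2) - β (plaqAt ba.1 ba.2)) ^ 2)
    (hEL : ∀ φ : E4 → Fin 4 → ℝ, ContDiff ℝ ∞ φ → HasCompactSupport φ → firstVar α β A φ = 0)
    (hφ : ContDiff ℝ ∞ φ) (hφs : HasCompactSupport φ) :
    penaltyActionFix α β A ≤ penaltyActionFix α β (A + φ) := by
  have h := penaltyActionFix_add_smul hA hkin hpen (contDiff_one_of_smooth hφ) hφs 1 (α := α) (β := β)
  rw [one_smul, hEL φ hφ hφs] at h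
  rw [h]
  nlinarith [penaltyActionFix_nonneg α 0 φ]

/-- **Minimiser ⇔ Euler–Lagrange** for (3.4) on the class of smooth compactly supported perturbations.
[cite: Federbush1986PhaseCellI, (3.4) p. 327, (3.11) p. 328] -/
theorem isMin_iff_firstVar_eq_zero (hA : ContDiff ℝ 1 A) (hkin : Integrable fun x => ∑ i, ∑ j, (pd A j i x) ^ 2)
    (hpen : Summable fun ba : (Fin 4 → ℤ) × Fin 6 => (plaqFunctional 0 A (plaqAt ba.1 ba.2) - β (plaqAt ba.1 ba.2)) ^ 2) :
    (∀ φ : E4 → Fin 4 → ℝ, ContDiff ℝ ∞ φ → HasCompactSupport φ →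
        penaltyActionFix α β A ≤ penaltyActionFix α β (A + φ))
      ↔ ∀ φ : E4 → Fin 4 → ℝ, ContDiff ℝ ∞ φ → HasCompactSupport φ → firstVar α β A φ = 0 :=
  ⟨fun hmin _ hφ hφs => firstVar_eq_zero_of_isMin hA hkin hpen hmin hφ hφs,
    fun hEL _ hφ hφs => isMin_of_firstVar_eq_zero hA hkin hpen hEL hφ hφs⟩

/-! ## §3 Integration by parts: the first variation is `∫ A′·(Dφ) − α² Σ_γ β_γ (χ_γ, φ)` with `D` = (3.5) -/

/-- `A_i · ∂_j∂_jφ_i`-type products are integrable (continuous times compactly supported continuous).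
[cite: Federbush1986PhaseCellI, (3.5) p. 327] -/
theorem integrable_apply_mul_pdpd (hA : Continuous A) (hφ : ContDiff ℝ ∞ φ) (hφs : HasCompactSupport φ) (i j : Fin 4) :
    Integrable fun x => A x i * pd (fun y ν => pd φ j ν y) j i x :=
  ((continuous_apply_field hA i).mul (continuous_pd (contDiff_pdField hφ j) j i)).integrable_of_hasCompactSupport
    (HasCompactSupport.mul_left (f := fun x => A x i) (hasCompactSupport_pd (hasCompactSupport_pdField hφs j) j i))

/-- **Integration by parts, one pair of indices**: `∫ ∂_jA_i ∂_jφ_i d⁴x = −∫ A_i ∂_j∂_jφ_i d⁴x` (`A` of class `C¹`, `φ` smooth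
compactly supported; no boundary term). [cite: Federbush1986PhaseCellI, (3.4)–(3.5) p. 327] -/
theorem integral_pd_mul_pd (hA : ContDiff ℝ 1 A) (hφ : ContDiff ℝ ∞ φ) (hφs : HasCompactSupport φ) (i j : Fin 4) :
    ∫ x, pd A j i x * pd φ j i x = -∫ x, A x i * pd (fun y ν => pd φ j ν y) j i x := by
  have hgC : ContDiff ℝ ∞ (fun y => pd φ j i y) := contDiff_pi.1 (contDiff_pdField hφ j) i
  have hf : ∀ x, DifferentiableAt ℝ (fun y => A y i) x := fun x => ModeLinearity.differentiableAt_apply hA i x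
  have hg : ∀ x, DifferentiableAt ℝ (fun y => pd φ j i y) x := fun x =>
    (hgC.differentiable (by simp)).differentiableAt
  have e1 : (fun x => fderiv ℝ (fun y => A y i) x (unitVec j) * pd φ j i x) = fun x => pd A j i x * pd φ j i x := rfl
  have e2 : (fun x => A x i * fderiv ℝ (fun y => pd φ j i y) x (unitVec j))
      = fun x => A x i * pd (fun y ν => pd φ j ν y) j i x := rfl
  have hf'g : Integrable fun x => fderiv ℝ (fun y => A y i) x (unitVec j) * pd φ j i x := by
    rw [e1]
    exact ((continuous_pd_of_contDiff hA j i).mul (continuous_pd_of_contDiff (contDiff_one_of_smooth hφ) j i))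
      |>.integrable_of_hasCompactSupport (HasCompactSupport.mul_left (f := fun x => pd A j i x) (hasCompactSupport_pd hφs j i))
  have hfg' : Integrable fun x => A x i * fderiv ℝ (fun y => pd φ j i y) x (unitVec j) := by
    rw [e2]
    exact integrable_apply_mul_pdpd hA.continuous hφ hφs i j
  have hfg : Integrable fun x => A x i * pd φ j i x :=
    ((continuous_apply_field hA.continuous i).mul (continuous_pd hφ j i)).integrable_of_hasCompactSupport
      (HasCompactSupport.mul_left (f := fun x => A x i) (hasCompactSupport_pd hφs j i))
  have key := integral_mul_fderiv_eq_neg_fderiv_mul_of_integrable (μ := (volume : Measure E4)) (v := unitVec j)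
    (f := fun y => A y i) (g := fun y => pd φ j i y) hf'g hfg' hfg (fun x _ => hf x) (fun x _ => hg x)
  rw [e1, e2] at key
  rw [key, neg_neg]

/-- **The kinetic pairing through the Laplacian**: `∫ Σ_{i,j} ∂_jA_i ∂_jφ_i = ∫ Σ_i A_i·(−Σ_j ∂_j∂_jφ_i)` — the `−Δ` of (3.5).
[cite: Federbush1986PhaseCellI, (3.4)–(3.5) p. 327] -/
theorem integral_kinCross_eq_neg_laplacian (hA : ContDiff ℝ 1 A) (hφ : ContDiff ℝ ∞ φ) (hφs : HasCompactSupport φ) :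
    ∫ x, ∑ i, ∑ j, pd A j i x * pd φ j i x = ∫ x, ∑ i, A x i * -(∑ j, pd (fun y ν => pd φ j ν y) j i x) := by
  have hφ1 : ContDiff ℝ 1 φ := contDiff_one_of_smooth hφ
  have hI1 : ∀ i j, Integrable fun x => pd A j i x * pd φ j i x := fun i j =>
    ((continuous_pd_of_contDiff hA j i).mul (continuous_pd_of_contDiff hφ1 j i)).integrable_of_hasCompactSupport
      (HasCompactSupport.mul_left (f := fun x => pd A j i x) (hasCompactSupport_pd hφs j i))
  have hI2 : ∀ i j, Integrable fun x => A x i * pd (fun y ν => pd φ j ν y) j i x := fun i j =>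
    integrable_apply_mul_pdpd hA.continuous hφ hφs i j
  have hI2n : ∀ i j, Integrable fun x => -(A x i * pd (fun y ν => pd φ j ν y) j i x) := fun i j => (hI2 i j).neg
  have hL : ∫ x, ∑ i, ∑ j, pd A j i x * pd φ j i x = ∑ i, ∑ j, ∫ x, pd A j i x * pd φ j i x := by
    rw [integral_finsetSum _ fun i _ => integrable_finsetSum _ fun j _ => hI1 i j]
    exact Finset.sum_congr rfl fun i _ => integral_finsetSum _ fun j _ => hI1 i j
  have hR : ∫ x, ∑ i, A x i * -(∑ j, pd (fun y ν => pd φ j ν y) j i x)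
      = ∑ i, ∑ j, -∫ x, A x i * pd (fun y ν => pd φ j ν y) j i x := by
    have hpt : (fun x => ∑ i, A x i * -(∑ j, pd (fun y ν => pd φ j ν y) j i x))
        = fun x => ∑ i, ∑ j, -(A x i * pd (fun y ν => pd φ j ν y) j i x) := by
      funext x
      simp only [mul_neg, Finset.mul_sum, Finset.sum_neg_distrib]
    rw [hpt, integral_finsetSum _ fun i _ => integrable_finsetSum _ fun j _ => hI2n i j]
    refine Finset.sum_congr rfl fun i _ => ?_
    rw [integral_finsetSum _ fun j _ => hI2n i j]
    exact Finset.sum_congr rfl fun j _ => integral_neg _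
  rw [hL, hR]
  exact Finset.sum_congr rfl fun i _ => Finset.sum_congr rfl fun j _ => integral_pd_mul_pd hA hφ hφs i j

/-- **The penalty pairing through `χ_γ(χ_γ, ·)`**: `Σ_{(b,a)} (χ_{⟨b,a⟩}, A)(χ_{⟨b,a⟩}, φ) = ∫ Σ_μ A_μ(x) [Σ_{(b,a)} χ_{⟨b,a⟩}(x)_μ
(χ_{⟨b,a⟩}, φ)] d⁴x` — the (finite) plaquette sum exchanged with `∫d⁴x`. [cite: Federbush1986PhaseCellI, (3.3)–(3.5) p. 327] -/
theorem tsum_plaqFunctional_mul_eq_integral (hA : Continuous A) (hφ : Continuous φ) (hφs : HasCompactSupport φ) :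
    ∑' ba : (Fin 4 → ℤ) × Fin 6, plaqFunctional 0 A (plaqAt ba.1 ba.2) * plaqFunctional 0 φ (plaqAt ba.1 ba.2)
      = ∫ x, ∑ μ, A x μ * ∑' ba : (Fin 4 → ℤ) × Fin 6,
          plaqTestField (plaqAt ba.1 ba.2) x μ * plaqFunctional 0 φ (plaqAt ba.1 ba.2) := by
  obtain ⟨T, hQ⟩ := exists_finset_prod_plaqFunctional_eq_zero hφ hφs
  rw [tsum_eq_sum (s := T) (fun ba hba => by rw [hQ ba hba, mul_zero])]
  have hin : ∀ x μ, ∑' ba : (Fin 4 → ℤ) × Fin 6, plaqTestField (plaqAt ba.1 ba.2) x μ * plaqFunctional 0 φ (plaqAt ba.1 ba.2)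
      = ∑ ba ∈ T, plaqTestField (plaqAt ba.1 ba.2) x μ * plaqFunctional 0 φ (plaqAt ba.1 ba.2) := fun x μ =>
    tsum_eq_sum (s := T) fun ba hba => by rw [hQ ba hba, mul_zero]
  simp_rw [hin]
  have hpt : (fun x => ∑ μ, A x μ * ∑ ba ∈ T, plaqTestField (plaqAt ba.1 ba.2) x μ * plaqFunctional 0 φ (plaqAt ba.1 ba.2))
      = fun x => ∑ ba ∈ T, plaqFunctional 0 φ (plaqAt ba.1 ba.2) * ∑ μ, plaqTestField (plaqAt ba.1 ba.2) x μ * A x μ := by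
    funext x
    simp only [Finset.mul_sum]
    rw [Finset.sum_comm]
    exact Finset.sum_congr rfl fun ba _ => Finset.sum_congr rfl fun μ _ => by ring
  rw [hpt, integral_finsetSum _ fun ba _ => (integrable_sum_plaqTestField_mul hA _).const_mul _]
  refine Finset.sum_congr rfl fun ba _ => ?_
  rw [integral_const_mul, ← plaqFunctional_eq_integral_plaqTestField hA, mul_comm]

/-- Integrability of `A·(−Δφ)` summed over components. [cite: Federbush1986PhaseCellI, (3.5) p. 327] -/
theorem integrable_apply_mul_neg_laplacian (hA : Continuous A) (hφ : ContDiff ℝ ∞ φ) (hφs : HasCompactSupport φ) :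
    Integrable fun x => ∑ μ, A x μ * -(∑ j, pd (fun y ν => pd φ j ν y) j μ x) := by
  have hn : ∀ μ j, Integrable fun x => -(A x μ * pd (fun y ν => pd φ j ν y) j μ x) := fun μ j =>
    (integrable_apply_mul_pdpd hA hφ hφs μ j).neg
  refine (integrable_finsetSum (Finset.univ : Finset (Fin 4)) fun μ _ =>
    integrable_finsetSum (Finset.univ : Finset (Fin 4)) fun j _ => hn μ j).congr (ae_of_all _ fun x => ?_)
  simp only [mul_neg, Finset.mul_sum, Finset.sum_neg_distrib]

/-- Integrability of `A·Σ_γ χ_γ(χ_γ, φ)` summed over components (a finite plaquette sum).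
[cite: Federbush1986PhaseCellI, (3.5) p. 327] -/
theorem integrable_apply_mul_penalty (hA : Continuous A) (hφ : Continuous φ) (hφs : HasCompactSupport φ) :
    Integrable fun x => ∑ μ, A x μ * ∑' ba : (Fin 4 → ℤ) × Fin 6,
      plaqTestField (plaqAt ba.1 ba.2) x μ * plaqFunctional 0 φ (plaqAt ba.1 ba.2) := by
  obtain ⟨T, hQ⟩ := exists_finset_prod_plaqFunctional_eq_zero hφ hφs
  have hin : ∀ x μ, ∑' ba : (Fin 4 → ℤ) × Fin 6, plaqTestField (plaqAt ba.1 ba.2) x μ * plaqFunctional 0 φ (plaqAt ba.1 ba.2)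
      = ∑ ba ∈ T, plaqTestField (plaqAt ba.1 ba.2) x μ * plaqFunctional 0 φ (plaqAt ba.1 ba.2) := fun x μ =>
    tsum_eq_sum (s := T) fun ba hba => by rw [hQ ba hba, mul_zero]
  refine (integrable_finsetSum T fun ba _ =>
    (integrable_sum_plaqTestField_mul hA (plaqAt ba.1 ba.2)).const_mul
      (plaqFunctional 0 φ (plaqAt ba.1 ba.2))).congr (ae_of_all _ fun x => ?_)
  simp only [hin, Finset.mul_sum]
  rw [Finset.sum_comm]
  exact Finset.sum_congr rfl fun μ _ => Finset.sum_congr rfl fun ba _ => by ring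

/-- **`∫ A·(Dφ)` SPLIT along (3.5)**: `∫ Σ_μ A_μ (Dφ)_μ = ∫ Σ_μ A_μ(−Δφ)_μ + α² ∫ Σ_μ A_μ Σ_γ χ_{γ,μ}(χ_γ, φ)`.
[cite: Federbush1986PhaseCellI, (3.5) p. 327] -/
theorem integral_mul_opDPosFix_eq_add (hA : Continuous A) (hφ : ContDiff ℝ ∞ φ) (hφs : HasCompactSupport φ) (α : ℝ) :
    ∫ x, ∑ μ, A x μ * opDPosFix α φ x μ
      = (∫ x, ∑ μ, A x μ * -(∑ j, pd (fun y ν => pd φ j ν y) j μ x))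
        + α ^ 2 * ∫ x, ∑ μ, A x μ * ∑' ba : (Fin 4 → ℤ) × Fin 6,
            plaqTestField (plaqAt ba.1 ba.2) x μ * plaqFunctional 0 φ (plaqAt ba.1 ba.2) := by
  have hpt : (fun x => ∑ μ, A x μ * opDPosFix α φ x μ)
      = fun x => (∑ μ, A x μ * -(∑ j, pd (fun y ν => pd φ j ν y) j μ x))
          + α ^ 2 * ∑ μ, A x μ * ∑' ba : (Fin 4 → ℤ) × Fin 6,
              plaqTestField (plaqAt ba.1 ba.2) x μ * plaqFunctional 0 φ (plaqAt ba.1 ba.2) := by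
    funext x
    unfold opDPosFix
    rw [Finset.mul_sum, ← Finset.sum_add_distrib]
    exact Finset.sum_congr rfl fun μ _ => by ring
  rw [hpt, integral_add (integrable_apply_mul_neg_laplacian hA hφ hφs)
    ((integrable_apply_mul_penalty hA hφ.continuous hφs).const_mul _), integral_const_mul]

/-- **THE FIRST VARIATION THROUGH `D` (3.5)**: `δS(A′; φ) = ∫ A′·(Dφ) d⁴x − α² Σ_γ β_γ (χ_γ, φ)` for a `C¹` field `A′` and a
smooth compactly supported `φ` (integration by parts in the kinetic term, exchange of the finite plaquette sum with `∫d⁴x` in the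
penalty term). [cite: Federbush1986PhaseCellI, (3.4)–(3.5) p. 327, (3.11) p. 328] -/
theorem firstVar_eq_integral_opDPosFix (hA : ContDiff ℝ 1 A) (hφ : ContDiff ℝ ∞ φ) (hφs : HasCompactSupport φ) :
    firstVar α β A φ = (∫ x, ∑ μ, A x μ * opDPosFix α φ x μ)
      - α ^ 2 * ∑' ba : (Fin 4 → ℤ) × Fin 6, β (plaqAt ba.1 ba.2) * plaqFunctional 0 φ (plaqAt ba.1 ba.2) := by
  obtain ⟨T, hQ⟩ := exists_finset_prod_plaqFunctional_eq_zero hφ.continuous hφs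
  have hPQ : Summable fun ba : (Fin 4 → ℤ) × Fin 6 =>
      plaqFunctional 0 A (plaqAt ba.1 ba.2) * plaqFunctional 0 φ (plaqAt ba.1 ba.2) :=
    summable_of_ne_finset_zero (s := T) fun ba hba => by rw [hQ ba hba, mul_zero]
  have hβQ : Summable fun ba : (Fin 4 → ℤ) × Fin 6 => β (plaqAt ba.1 ba.2) * plaqFunctional 0 φ (plaqAt ba.1 ba.2) :=
    summable_of_ne_finset_zero (s := T) fun ba hba => by rw [hQ ba hba, mul_zero]
  have h1 : ∑' ba : (Fin 4 → ℤ) × Fin 6,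
      (plaqFunctional 0 A (plaqAt ba.1 ba.2) - β (plaqAt ba.1 ba.2)) * plaqFunctional 0 φ (plaqAt ba.1 ba.2)
      = (∑' ba : (Fin 4 → ℤ) × Fin 6, plaqFunctional 0 A (plaqAt ba.1 ba.2) * plaqFunctional 0 φ (plaqAt ba.1 ba.2))
        - ∑' ba : (Fin 4 → ℤ) × Fin 6, β (plaqAt ba.1 ba.2) * plaqFunctional 0 φ (plaqAt ba.1 ba.2) := by
    rw [← hPQ.tsum_sub hβQ]
    exact tsum_congr fun ba => by ring
  unfold firstVar
  rw [h1, integral_kinCross_eq_neg_laplacian hA hφ hφs, tsum_plaqFunctional_mul_eq_integral hA.continuous hφ.continuous hφs,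
    integral_mul_opDPosFix_eq_add hA.continuous hφ hφs α]
  ring

/-- **(3.11) IN POSITION SPACE — «From (3.4) we see the minimizing A′ will satisfy A′ = α²C Σ_γ β_γχ_γ»**: a `C¹` field `A′` of
finite penalised action that minimises (3.4) against every smooth compactly supported perturbation satisfies, for every smooth
compactly supported `φ`, `∫ A′·(Dφ) d⁴x = α² Σ_γ β_γ (χ_γ, φ)` with `D = −Δ + α²Σ_γ χ_γχ_γ` (3.5) (`opDPosFix`): `D A′ =
α² Σ_γ β_γ χ_γ` in the sense of distributions, which through «C = D⁻¹» (the tree's `PlaquetteGram.opC_opD` on every momentum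
fibre) is (3.11). [cite: Federbush1986PhaseCellI, (3.4)–(3.5) p. 327, (3.11) p. 328] -/
theorem integral_mul_opDPosFix_eq_of_isMin (hA : ContDiff ℝ 1 A) (hkin : Integrable fun x => ∑ i, ∑ j, (pd A j i x) ^ 2)
    (hpen : Summable fun ba : (Fin 4 → ℤ) × Fin 6 => (plaqFunctional 0 A (plaqAt ba.1 ba.2) - β (plaqAt ba.1 ba.2)) ^ 2)
    (hmin : ∀ φ : E4 → Fin 4 → ℝ, ContDiff ℝ ∞ φ → HasCompactSupport φ →
      penaltyActionFix α β A ≤ penaltyActionFix α β (A + φ))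
    (hφ : ContDiff ℝ ∞ φ) (hφs : HasCompactSupport φ) :
    ∫ x, ∑ μ, A x μ * opDPosFix α φ x μ
      = α ^ 2 * ∑' ba : (Fin 4 → ℤ) × Fin 6, β (plaqAt ba.1 ba.2) * plaqFunctional 0 φ (plaqAt ba.1 ba.2) := by
  have h := firstVar_eq_zero_of_isMin hA hkin hpen hmin hφ hφs
  rw [firstVar_eq_integral_opDPosFix hA hφ hφs] at h
  linarith

/-- **Minimiser ⇔ the distributional equation `D A′ = α² Σ_γ β_γ χ_γ`** (on smooth compactly supported perturbations / test
fields). [cite: Federbush1986PhaseCellI, (3.4)–(3.5) p. 327, (3.11) p. 328] -/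
theorem isMin_iff_integral_mul_opDPosFix_eq (hA : ContDiff ℝ 1 A) (hkin : Integrable fun x => ∑ i, ∑ j, (pd A j i x) ^ 2)
    (hpen : Summable fun ba : (Fin 4 → ℤ) × Fin 6 => (plaqFunctional 0 A (plaqAt ba.1 ba.2) - β (plaqAt ba.1 ba.2)) ^ 2) :
    (∀ φ : E4 → Fin 4 → ℝ, ContDiff ℝ ∞ φ → HasCompactSupport φ →
        penaltyActionFix α β A ≤ penaltyActionFix α β (A + φ))
      ↔ ∀ φ : E4 → Fin 4 → ℝ, ContDiff ℝ ∞ φ → HasCompactSupport φ →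
          ∫ x, ∑ μ, A x μ * opDPosFix α φ x μ
            = α ^ 2 * ∑' ba : (Fin 4 → ℤ) × Fin 6, β (plaqAt ba.1 ba.2) * plaqFunctional 0 φ (plaqAt ba.1 ba.2) := by
  refine ⟨fun hmin φ hφ hφs => integral_mul_opDPosFix_eq_of_isMin hA hkin hpen hmin hφ hφs, fun hEL φ hφ hφs => ?_⟩
  refine isMin_of_firstVar_eq_zero hA hkin hpen (fun ψ hψ hψs => ?_) hφ hφs
  rw [firstVar_eq_integral_opDPosFix hA hψ hψs, hEL ψ hψ hψs, sub_self]

/-! ## §4 The source `α² Σ_γ β_γ χ_γ` as a field, the equation as an identity of distributions, symmetry of `D` -/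

/-- **The source of (3.11) in position space**: `(α² Σ_γ β_γ χ_γ)(x)_μ = α² Σ_{(b,a)} β_{⟨b,a⟩} χ_{⟨b,a⟩}(x)_μ` — a locally finite
sum (at each `x` only the plaquettes with corner in a bounded box have `χ_γ(x) ≠ 0`), for every `β`.
[cite: Federbush1986PhaseCellI, (3.11) p. 328, (3.5) p. 327] -/
def srcPos (α : ℝ) (β : Plaq 0 → ℝ) (x : E4) (μ : Fin 4) : ℝ :=
  α ^ 2 * ∑' ba : (Fin 4 → ℤ) × Fin 6, β (plaqAt ba.1 ba.2) * plaqTestField (plaqAt ba.1 ba.2) x μ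

/-- The lattice points of sup-norm at most `N` form a finite set. [folklore] -/
private theorem finite_latBox' (N : ℤ) : Set.Finite {m : Fin 4 → ℤ | ∀ k, |m k| ≤ N} := by
  have h : {m : Fin 4 → ℤ | ∀ k, |m k| ≤ N} ⊆ Set.univ.pi fun _ : Fin 4 => Set.Icc (-N) N := by
    intro m hm
    simp only [Set.mem_pi, Set.mem_univ, true_implies, Set.mem_Icc]
    exact fun k => abs_le.mp (hm k)
  exact (Set.Finite.pi fun _ => Set.finite_Icc (-N) N).subset h

/-- **Uniformly on a compact set, only finitely many plaquettes have `χ_γ ≠ 0`**: for compact `K ⊂ ℝ⁴` there is a finite set of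
corners outside which `χ_q` vanishes identically on `K`. [cite: Federbush1986PhaseCellI, (3.9) p. 328] -/
theorem exists_finset_plaqTestField_eq_zero_on {K : Set E4} (hK : IsCompact K) :
    ∃ B : Finset (Fin 4 → ℤ), ∀ q : Plaq 0, q.base ∉ B → ∀ x ∈ K, ∀ μ, plaqTestField q x μ = 0 := by
  obtain ⟨R, hR⟩ := hK.isBounded.subset_closedBall (0 : E4)
  obtain ⟨N, hN⟩ := exists_nat_ge (R + 2)
  refine ⟨(finite_latBox' N).toFinset, fun q hq x hx μ => plaqTestField_eq_zero_of_not_mem q (fun hmem => hq ?_) μ⟩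
  rw [Set.Finite.mem_toFinset]
  intro k
  have hxR : ‖x‖ ≤ R := by
    have := hR hx
    rwa [Metric.mem_closedBall, dist_zero_right] at this
  have hxk : |x k| ≤ R := by
    have h := PiLp.norm_apply_le x k
    rw [Real.norm_eq_abs] at h
    exact h.trans hxR
  have h1 := hmem.1 k
  have h2 := hmem.2 k
  simp only [cubeCoord_apply, latLen, pow_zero, inv_one, one_mul, Plaq.src, mkPt, Pi.ofNat_apply] at h1 h2
  have h1' : (q.base k : ℝ) ≤ x k := by
    have : (0 : ℝ) ≤ x k - q.base k := by simpa using h1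
    linarith
  have h2' : x k - 2 ≤ (q.base k : ℝ) := by
    have : x k - (q.base k : ℝ) ≤ 2 := by simpa using h2
    linarith
  have : |(q.base k : ℝ)| ≤ N := by
    rw [abs_le]
    constructor <;> [linarith [neg_abs_le (x k)]; linarith [le_abs_self (x k)]]
  exact_mod_cast this

/-- For a compactly supported `φ`: a finite set of plaquettes outside which `χ_γ(x)·φ(x)` vanishes at EVERY point (so both the
pointwise products and the pairings `(χ_γ, φ)` vanish there). [cite: Federbush1986PhaseCellI, (3.9) p. 328] -/
theorem exists_finset_plaqTestField_mul_eq_zero (hφ : Continuous φ) (hφs : HasCompactSupport φ) :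
    ∃ T : Finset ((Fin 4 → ℤ) × Fin 6), ∀ ba ∉ T,
      (∀ x μ, plaqTestField (plaqAt ba.1 ba.2) x μ * φ x μ = 0) ∧ plaqFunctional 0 φ (plaqAt ba.1 ba.2) = 0 := by
  obtain ⟨B, hB⟩ := exists_finset_plaqTestField_eq_zero_on hφs.isCompact
  have hpt : ∀ ba : (Fin 4 → ℤ) × Fin 6, ba ∉ B ×ˢ (Finset.univ : Finset (Fin 6)) →
      ∀ x μ, plaqTestField (plaqAt ba.1 ba.2) x μ * φ x μ = 0 := by
    intro ba hba x μ
    have hb : ba.1 ∉ B := fun h => hba (Finset.mem_product.mpr ⟨h, Finset.mem_univ _⟩)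
    by_cases hx : x ∈ tsupport φ
    · rw [hB (plaqAt ba.1 ba.2) hb x hx μ, zero_mul]
    · rw [image_eq_zero_of_notMem_tsupport hx, Pi.zero_apply, mul_zero]
  refine ⟨B ×ˢ Finset.univ, fun ba hba => ⟨hpt ba hba, ?_⟩⟩
  rw [plaqFunctional_eq_integral_plaqTestField hφ]
  simp only [hpt ba hba, Finset.sum_const_zero, integral_zero]

/-- **The source field integrated against a test field**: `∫ Σ_μ (α² Σ_γ β_γ χ_γ)(x)_μ φ_μ(x) d⁴x = α² Σ_γ β_γ (χ_γ, φ)`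
(every `β`; continuous compactly supported `φ`). [cite: Federbush1986PhaseCellI, (3.11) p. 328, (3.3) p. 327] -/
theorem integral_srcPos_mul (α : ℝ) (β : Plaq 0 → ℝ) (hφ : Continuous φ) (hφs : HasCompactSupport φ) :
    ∫ x, ∑ μ, srcPos α β x μ * φ x μ
      = α ^ 2 * ∑' ba : (Fin 4 → ℤ) × Fin 6, β (plaqAt ba.1 ba.2) * plaqFunctional 0 φ (plaqAt ba.1 ba.2) := by
  obtain ⟨T, hT⟩ := exists_finset_plaqTestField_mul_eq_zero hφ hφs
  -- pointwise: the integrand is a finite sum over `T`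
  have hpt : (fun x => ∑ μ, srcPos α β x μ * φ x μ)
      = fun x => ∑ ba ∈ T, (α ^ 2 * β (plaqAt ba.1 ba.2)) * ∑ μ, plaqTestField (plaqAt ba.1 ba.2) x μ * φ x μ := by
    funext x
    have hin : ∀ μ, srcPos α β x μ * φ x μ
        = ∑ ba ∈ T, (α ^ 2 * β (plaqAt ba.1 ba.2)) * (plaqTestField (plaqAt ba.1 ba.2) x μ * φ x μ) := by
      intro μ
      unfold srcPos
      rw [mul_assoc, ← tsum_mul_right, tsum_eq_sum (s := T) (fun ba hba => by rw [mul_assoc, (hT ba hba).1 x μ, mul_zero]),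
        Finset.mul_sum]
      exact Finset.sum_congr rfl fun ba _ => by ring
    simp only [hin]
    rw [Finset.sum_comm]
    exact Finset.sum_congr rfl fun ba _ => by rw [Finset.mul_sum]
  rw [hpt, integral_finsetSum _ fun ba _ => ?_]
  · rw [tsum_eq_sum (s := T) (fun ba hba => by rw [(hT ba hba).2, mul_zero]), Finset.mul_sum]
    refine Finset.sum_congr rfl fun ba _ => ?_
    rw [integral_const_mul, plaqFunctional_eq_integral_plaqTestField hφ]
    ring
  · refine Integrable.const_mul ?_ _
    have h := integrable_sum_plaqTestField_mul hφ (plaqAt ba.1 ba.2)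
    exact h

/-- **(3.11) AS AN IDENTITY OF DISTRIBUTIONS**: for the minimiser `A′` of (3.4) (hypotheses of
`integral_mul_opDPosFix_eq_of_isMin`), `∫ A′·(Dφ) d⁴x = ∫ (α² Σ_γ β_γ χ_γ)·φ d⁴x` for every smooth compactly supported `φ` —
`D A′ = α² Σ_γ β_γ χ_γ`, i.e. «A′ = α²C Σ_γ β_γχ_γ» with «C = D⁻¹». [cite: Federbush1986PhaseCellI, (3.11) p. 328, (3.4)–(3.5) p. 327] -/
theorem weak311_of_isMin (hA : ContDiff ℝ 1 A) (hkin : Integrable fun x => ∑ i, ∑ j, (pd A j i x) ^ 2)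
    (hpen : Summable fun ba : (Fin 4 → ℤ) × Fin 6 => (plaqFunctional 0 A (plaqAt ba.1 ba.2) - β (plaqAt ba.1 ba.2)) ^ 2)
    (hmin : ∀ φ : E4 → Fin 4 → ℝ, ContDiff ℝ ∞ φ → HasCompactSupport φ →
      penaltyActionFix α β A ≤ penaltyActionFix α β (A + φ))
    (hφ : ContDiff ℝ ∞ φ) (hφs : HasCompactSupport φ) :
    ∫ x, ∑ μ, A x μ * opDPosFix α φ x μ = ∫ x, ∑ μ, srcPos α β x μ * φ x μ := by
  rw [integral_mul_opDPosFix_eq_of_isMin hA hkin hpen hmin hφ hφs, integral_srcPos_mul α β hφ.continuous hφs]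

/-- The first variation with zero data is symmetric in the two fields. [cite: Federbush1986PhaseCellI, (3.4) p. 327] -/
theorem firstVar_zero_comm (ψ φ : E4 → Fin 4 → ℝ) : firstVar α 0 ψ φ = firstVar α 0 φ ψ := by
  unfold firstVar
  simp only [Pi.zero_apply, sub_zero]
  congr 1
  · exact integral_congr_ae (ae_of_all _ fun x =>
      Finset.sum_congr rfl fun i _ => Finset.sum_congr rfl fun j _ => mul_comm _ _)
  · exact congrArg _ (tsum_congr fun ba => mul_comm _ _)

/-- **`D` (3.5) is symmetric on the test fields**: `∫ ψ·(Dφ) d⁴x = ∫ (Dψ)·φ d⁴x` for smooth compactly supported `ψ`, `φ` (both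
sides equal `∫Σ∂_jψ_i∂_jφ_i + α²Σ_γ(χ_γ, ψ)(χ_γ, φ)`), so that `∫ A′·(Dφ)` is the distribution `DA′` evaluated at `φ`.
[cite: Federbush1986PhaseCellI, (3.5) p. 327] -/
theorem integral_mul_opDPosFix_comm (hψ : ContDiff ℝ ∞ ψ) (hψs : HasCompactSupport ψ) (hφ : ContDiff ℝ ∞ φ)
    (hφs : HasCompactSupport φ) (α : ℝ) :
    ∫ x, ∑ μ, ψ x μ * opDPosFix α φ x μ = ∫ x, ∑ μ, opDPosFix α ψ x μ * φ x μ := by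
  have h1 := firstVar_eq_integral_opDPosFix (α := α) (β := 0) (contDiff_one_of_smooth hψ) hφ hφs
  have h2 := firstVar_eq_integral_opDPosFix (α := α) (β := 0) (contDiff_one_of_smooth hφ) hψ hψs
  simp only [Pi.zero_apply, zero_mul, tsum_zero, mul_zero, sub_zero] at h1 h2
  rw [← h1, firstVar_zero_comm, h2]
  exact integral_congr_ae (ae_of_all _ fun x => Finset.sum_congr rfl fun μ _ => mul_comm _ _)

end LandauPenalty

end

end Literature.MathematicalPhysics.QuantumFieldTheory.Federbush1986
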